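import Summits.QuantumFields.BalabanUV.T4Continuum.Support.NE3FrameFreeSliceW
import Summits.QuantumFields.BalabanUV.T4Continuum.Support.NE3SpectralCutTorus
import Summits.QuantumFields.BalabanUV.T4Continuum.Support.NE3SlicePoincareShape
import HarnessLib

/-!
# NE3SlicePoincareSkeleton (T⁴ programme, node NE3, row K6 of the owner's ruling ρ-g22-2, part K6a of the cut ρ-g23-3 §3) — THE S6∘S8 STEP
# OF ROUTE H♮ («min-norm against the competitor, cross term through the spectral orthogonality»), CAUCHY–SCHWARZ ∕ ABSORPTION IN
# `hsR`-SUM CURRENCY, THE nhs → OPERATOR-NORM CONVERSION INTO `SlicePoincare`, AND THE ε-BUDGET LEMMA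

NE3 (node U1b) formalisation swarm `b2b-balaban-t4-ne3-formalise-*`, leaf seat `b2b-balaban-t4-ne3-formalise-leaf-02` (gen 6), row **K6**
(«ASSEMBLY S5∕S6∕S8 ⇒ (P♮)_W on T_♮(W)», booked → leaf-02 lineage by ρ-g22-2; blueprint `HOME/t4/b2b-balaban-t4-ne3-p1/g23/D-ne3p1-g23-1.md`
= ruling ρ-g23-3, whose §3 cut K6a ∕ K6b ∕ K6c is adopted; my INTENT ∕ CLAIM `HOME/CLAIMS.log` ≈18:4xZ).  THIS FILE = K6a: the parts of the
assembly that depend only on LANDED modules — K0b `NE3FrameFreeSliceW` (the slice `frameFreeBlockLandauW`, `Ξ₀₀(W) = cornerGaugeSpaceW`,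
(S6) `sum_nhsNormSq_le_of_mem`), K1-inst `NE3SpectralCutTorus`∕`NE3HilbertSchmidtTorus` (S1∕S2 and the `PiLp` packaging), the owner's wall
`NE3SlicePoincareShape.SlicePoincare`, leaf-04's `NE3LandauOrbit.sum_hsR_gaugeDir`.  All [folklore], 0 sorry, 0 def:
§1 CAUCHY–SCHWARZ AND ABSORPTION for `periodBox` sums of `hsR` (through `‖resS f‖² = Σ nhsNormSq f`): `abs_sum_hsR_le`, `abs_sum_sum_hsR_le`,
   `two_mul_abs_sum_hsR_le` (`2|Σ hsR f g| ≤ δ·Σ‖f‖² + δ⁻¹·Σ‖g‖²`);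
§2 THE S8 IDENTITY `sum_nhsNormSq_add_gaugeDir_eq` (`Σ‖η + D_Wζ‖² = Σ‖η‖² + Σ‖D_Wζ‖² + 2·Σ hsR (covDiv W η) ζ`, unitary `W`) and **THE S6∘S8 STEP
   `sum_nhsNormSq_le_competitor`**: for `Y ∈ frameFreeBlockLandauW L N k W` written as `Y = η′ + gaugeDir W ζ′` and ANY periodic competitor
   `ζ̃` with `ζ̃ − ζ′ ∈ Ξ₀₀(W)`: `y² ≤ h² + Σ‖D_Wζ̃‖² + 2·Σ_x hsR (covDiv W η′ x) (ζ̃ x)`; with (S2)(iii) `Σ hsR ζ′ ρ = 0` (`ρ := covDiv W η′`):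
   **`sum_nhsNormSq_le_competitor_of_orth`**: `y² ≤ h² + Σ‖D_Wζ̃‖² + 2·Σ_x hsR (ρ x) (ζ̃ x − ζ′ x)` — the blueprint's «`⟨ρ, ζ̃′⟩ = ⟨ρ, ξ⟩`»;
§3 CURRENCY: `dirSq_le_card_mul`, `sum_nhsNormSq_curl_le_curlSq`, **`slicePoincare_of_nhs`** (an nhs-currency slice inequality with constant
   `C·(L^k)²` IS `SlicePoincare L k W T (card n·C) F`);
§4 THE ε-BUDGET LEMMA `sq_le_of_budget` (pure `ℝ`): `y² ≤ h² + D² + X`, `h² ≤ a₁c + e₁y²`, `D² ≤ a₂c + e₂y²`, `X ≤ e₃y²`, `e₁ + e₂ + e₃ ≤ 1∕2`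
   ⇒ `y² ≤ 2(a₁ + a₂)c`.
K6b ((E) + the three remainder pairings of ρ-g23-3 §2, after K4-0 f2∕f3, K4-d1 f2, K6-tr, J4 land) and K6c (ε-choice, `SlicePoincare` BY NAME) follow.
HONEST FRAMING.  Bookkeeping and finite-dimensional linear algebra on OUR lattice objects at ONE unitary background; nothing about Bałaban's
minimisers; (P♮)_W, (ML_w) at `W ≠ 1`, T-E_w and NE3 are NOT proved; spine PROVED 0∕9; finite T⁴ rung (B)+1 — NOT infinite volume, NOT mass gap,
NOT BetaPertH, NOT Clay.  ABSOLUTE RULE kept: no printed sentence is a hypothesis (context only: [Balaban1985Variational] (83) p. 290;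
[Balaban1985PropagatorsII] Thm 3.3 (3.46)).  PLACEMENT: `Summits/QuantumFields/BalabanUV/`; imports accepted modules only; moves nothing.
HONEST DEPENDENCY: continuum YM on T⁴ ⇐ BetaPertH ∧ nine spine estimates (0/9 proved); BetaPertH ⇐ (D1) ∧ (D4) ∧ CAP+tail; G-an2-4
gates asym, D1 and NE2/3/4.
-/

set_option autoImplicit false

open scoped BigOperators InnerProductSpace Matrix.Norms.L2Operator
open Finset

namespace Summit.QuantumFields.BalabanUV.T4Continuum.NE3SlicePoincareSkeleton

open Literature.MathematicalPhysics.QuantumFieldTheory.Balaban1983to89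
open B7Prop1Explicit MatrixNorms
open T4AveragingDeficitWall (IsUnitaryCfg IsSkewDir Ad curl curlSq dirSq)
open T4AveragingDeficitWallBoundary (IsPeriodicCfg periodBox)
open AveragingDeficitPeriodicCounting (IsPeriodicDir)
open AveragingDeficitMultiLevelPrep (tower)
open BlockAveragePushDirGauge (gaugeDir)
open NE3CovariantCalculus (hsR hsR_add_right hsR_sub_right hsR_comm hsR_self)
open NE3CovariantWeitzenbock (covDiv)
open NE3LandauOrbit (nhsNormSq_add sum_hsR_gaugeDir)
open NE3FrameFreeSliceW (cornerGaugeSpaceW frameFreeBlockLandauW sum_nhsNormSq_le_of_mem)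
open NE3HilbertSchmidtTorus
open NE3SlicePoincareShape (SlicePoincare)

noncomputable section

variable {d : ℕ} {n : Type*} [Fintype n] [DecidableEq n]

/-! ## §1 Cauchy–Schwarz and absorption for `periodBox` sums of `hsR` -/

/-- `‖resS P f‖ = √(Σ_{periodBox P} nhsNormSq (f x))`. [folklore] -/
theorem norm_resS_eq_sqrt (P : ℕ) (f : Site d → Matrix n n ℂ) :
    ‖resS (d := d) P f‖ = Real.sqrt (∑ x ∈ periodBox (d := d) P, nhsNormSq (f x)) := by
  rw [← norm_sq_resS, Real.sqrt_sq (norm_nonneg _)]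

/-- `‖resF P Y‖ = √(Σ_{periodBox P} Σ_κ nhsNormSq (Y x κ))`. [folklore] -/
theorem norm_resF_eq_sqrt (P : ℕ) (Y : Site d → Fin d → Matrix n n ℂ) :
    ‖resF (d := d) P Y‖ = Real.sqrt (∑ x ∈ periodBox (d := d) P, ∑ κ : Fin d, nhsNormSq (Y x κ)) := by
  rw [← norm_sq_resF, Real.sqrt_sq (norm_nonneg _)]

/-- **CAUCHY–SCHWARZ FOR SITE FIELDS**: `|Σ_x hsR (f x) (g x)| ≤ √(Σ nhsNormSq f)·√(Σ nhsNormSq g)`. [folklore] -/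
theorem abs_sum_hsR_le (P : ℕ) (f g : Site d → Matrix n n ℂ) :
    |∑ x ∈ periodBox (d := d) P, hsR (f x) (g x)|
      ≤ Real.sqrt (∑ x ∈ periodBox (d := d) P, nhsNormSq (f x)) * Real.sqrt (∑ x ∈ periodBox (d := d) P, nhsNormSq (g x)) := by
  rw [← inner_resS, ← norm_resS_eq_sqrt, ← norm_resS_eq_sqrt]
  exact abs_real_inner_le_norm _ _

/-- **CAUCHY–SCHWARZ FOR DIRECTION FIELDS**: `|Σ_x Σ_κ hsR (Y x κ) (Z x κ)| ≤ √(ΣΣ nhsNormSq Y)·√(ΣΣ nhsNormSq Z)`. [folklore] -/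
theorem abs_sum_sum_hsR_le (P : ℕ) (Y Z : Site d → Fin d → Matrix n n ℂ) :
    |∑ x ∈ periodBox (d := d) P, ∑ κ : Fin d, hsR (Y x κ) (Z x κ)|
      ≤ Real.sqrt (∑ x ∈ periodBox (d := d) P, ∑ κ : Fin d, nhsNormSq (Y x κ))
        * Real.sqrt (∑ x ∈ periodBox (d := d) P, ∑ κ : Fin d, nhsNormSq (Z x κ)) := by
  rw [← inner_resF, ← norm_resF_eq_sqrt, ← norm_resF_eq_sqrt]
  exact abs_real_inner_le_norm _ _

/-- `2·√A·√B ≤ δ·A + δ⁻¹·B` for `0 ≤ A, B` and `0 < δ`. [folklore] -/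
theorem two_mul_sqrt_mul_sqrt_le {A B δ : ℝ} (hA : 0 ≤ A) (hB : 0 ≤ B) (hδ : 0 < δ) :
    2 * (Real.sqrt A * Real.sqrt B) ≤ δ * A + δ⁻¹ * B := by
  have hsA := Real.sq_sqrt hA
  have hsB := Real.sq_sqrt hB
  have hsδ : Real.sqrt δ ^ 2 = δ := Real.sq_sqrt hδ.le
  have hsδi : Real.sqrt δ⁻¹ ^ 2 = δ⁻¹ := Real.sq_sqrt (inv_nonneg.2 hδ.le)
  have hprod : Real.sqrt δ * Real.sqrt δ⁻¹ = 1 := by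
    rw [← Real.sqrt_mul hδ.le, mul_inv_cancel₀ hδ.ne', Real.sqrt_one]
  have e1 : (Real.sqrt δ * Real.sqrt A) ^ 2 = δ * A := by rw [mul_pow, hsδ, hsA]
  have e2 : (Real.sqrt δ⁻¹ * Real.sqrt B) ^ 2 = δ⁻¹ * B := by rw [mul_pow, hsδi, hsB]
  have e3 : (Real.sqrt δ * Real.sqrt A) * (Real.sqrt δ⁻¹ * Real.sqrt B) = Real.sqrt A * Real.sqrt B := by
    calc (Real.sqrt δ * Real.sqrt A) * (Real.sqrt δ⁻¹ * Real.sqrt B)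
        = (Real.sqrt δ * Real.sqrt δ⁻¹) * (Real.sqrt A * Real.sqrt B) := by ring
      _ = Real.sqrt A * Real.sqrt B := by rw [hprod, one_mul]
  have key : δ * A + δ⁻¹ * B - 2 * (Real.sqrt A * Real.sqrt B)
      = (Real.sqrt δ * Real.sqrt A - Real.sqrt δ⁻¹ * Real.sqrt B) ^ 2 := by
    linear_combination (-1 : ℝ) * e1 - e2 + 2 * e3
  nlinarith [sq_nonneg (Real.sqrt δ * Real.sqrt A - Real.sqrt δ⁻¹ * Real.sqrt B), key]

/-- **ABSORPTION**: `2·|Σ_x hsR (f x) (g x)| ≤ δ·Σ nhsNormSq f + δ⁻¹·Σ nhsNormSq g` (`0 < δ`). [folklore] -/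
theorem two_mul_abs_sum_hsR_le (P : ℕ) (f g : Site d → Matrix n n ℂ) {δ : ℝ} (hδ : 0 < δ) :
    2 * |∑ x ∈ periodBox (d := d) P, hsR (f x) (g x)|
      ≤ δ * ∑ x ∈ periodBox (d := d) P, nhsNormSq (f x) + δ⁻¹ * ∑ x ∈ periodBox (d := d) P, nhsNormSq (g x) := by
  have h := abs_sum_hsR_le (d := d) P f g
  have hA : 0 ≤ ∑ x ∈ periodBox (d := d) P, nhsNormSq (f x) := Finset.sum_nonneg fun _ _ => nhsNormSq_nonneg _
  have hB : 0 ≤ ∑ x ∈ periodBox (d := d) P, nhsNormSq (g x) := Finset.sum_nonneg fun _ _ => nhsNormSq_nonneg _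
  linarith [two_mul_sqrt_mul_sqrt_le hA hB hδ]

/-- **ABSORPTION FOR DIRECTION FIELDS**: `2·|ΣΣ hsR Y Z| ≤ δ·ΣΣ nhsNormSq Y + δ⁻¹·ΣΣ nhsNormSq Z` (`0 < δ`). [folklore] -/
theorem two_mul_abs_sum_sum_hsR_le (P : ℕ) (Y Z : Site d → Fin d → Matrix n n ℂ) {δ : ℝ} (hδ : 0 < δ) :
    2 * |∑ x ∈ periodBox (d := d) P, ∑ κ : Fin d, hsR (Y x κ) (Z x κ)|
      ≤ δ * ∑ x ∈ periodBox (d := d) P, ∑ κ : Fin d, nhsNormSq (Y x κ)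
        + δ⁻¹ * ∑ x ∈ periodBox (d := d) P, ∑ κ : Fin d, nhsNormSq (Z x κ) := by
  have h := abs_sum_sum_hsR_le (d := d) P Y Z
  have hA : 0 ≤ ∑ x ∈ periodBox (d := d) P, ∑ κ : Fin d, nhsNormSq (Y x κ) :=
    Finset.sum_nonneg fun _ _ => Finset.sum_nonneg fun _ _ => nhsNormSq_nonneg _
  have hB : 0 ≤ ∑ x ∈ periodBox (d := d) P, ∑ κ : Fin d, nhsNormSq (Z x κ) :=
    Finset.sum_nonneg fun _ _ => Finset.sum_nonneg fun _ _ => nhsNormSq_nonneg _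
  linarith [two_mul_sqrt_mul_sqrt_le hA hB hδ]

/-! ## §2 The S8 identity and the S6∘S8 step -/

/-- `gaugeDir W (ζ − ξ) = gaugeDir W ζ − gaugeDir W ξ` (function form). [folklore] -/
theorem gaugeDir_sub_fun' (W : Site d → Fin d → (Matrix n n ℂ)ˣ) (f g : Site d → Matrix n n ℂ) (x : Site d) (μ : Fin d) :
    gaugeDir W (fun y => f y - g y) x μ = gaugeDir W f x μ - gaugeDir W g x μ := by
  have h := gaugeDir_add_fun W (fun y => f y - g y) g x μ
  simp only [sub_add_cancel] at h
  rw [h]; abel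

/-- **THE S8 IDENTITY**: for unitary `W` and `P`-periodic `η`, `ζ` (`P ≥ 1`),
`Σ_{periodBox P} Σ_κ nhsNormSq (η x κ + gaugeDir W ζ x κ) = ΣΣ nhsNormSq η + ΣΣ nhsNormSq (gaugeDir W ζ) + 2·Σ_x hsR (covDiv W η x) (ζ x)`
(polarisation + leaf-04's Landau orthogonality `sum_hsR_gaugeDir`). [folklore] -/
theorem sum_nhsNormSq_add_gaugeDir_eq {P : ℕ} (hP : 1 ≤ P) {W : Site d → Fin d → (Matrix n n ℂ)ˣ} (hWu : IsUnitaryCfg W)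
    {η : Site d → Fin d → Matrix n n ℂ} (hη : IsPeriodicDir η (P : ℤ)) {ζ : Site d → Matrix n n ℂ}
    (hζ : ∀ (x : Site d) (τ : Fin d), ζ (x + (P : ℤ) • e τ) = ζ x) :
    ∑ x ∈ periodBox (d := d) P, ∑ κ : Fin d, nhsNormSq (η x κ + gaugeDir W ζ x κ)
      = ∑ x ∈ periodBox (d := d) P, ∑ κ : Fin d, nhsNormSq (η x κ)
        + ∑ x ∈ periodBox (d := d) P, ∑ κ : Fin d, nhsNormSq (gaugeDir W ζ x κ)
        + 2 * ∑ x ∈ periodBox (d := d) P, hsR (covDiv W η x) (ζ x) := by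
  simp_rw [nhsNormSq_add, Finset.sum_add_distrib, ← Finset.mul_sum]
  rw [sum_hsR_gaugeDir hP hWu hη hζ]

/-- **THE S6∘S8 STEP**: let `Y ∈ T_♮(W) = frameFreeBlockLandauW L N k W` be written as `Y = η′ + gaugeDir W ζ′` (pointwise) with `η′`
`P`-periodic (`P = tower L N k`, `W` unitary), and let `ζ̃` be ANY `P`-periodic competitor with `ζ̃ − ζ′ ∈ Ξ₀₀(W) = cornerGaugeSpaceW L k W P (L^k)`.
Then `Σ‖Y‖² ≤ Σ‖η′‖² + Σ‖gaugeDir W ζ̃‖² + 2·Σ_x hsR (covDiv W η′ x) (ζ̃ x)` — the min-norm property (S6) of the slice against the gauge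
direction `gaugeDir W (ζ̃ − ζ′)`, then the S8 identity. [folklore] -/
theorem sum_nhsNormSq_le_competitor {L N k : ℕ} (hP : 1 ≤ tower L N k) {W : Site d → Fin d → (Matrix n n ℂ)ˣ} (hWu : IsUnitaryCfg W)
    {Y : Site d → Fin d → Matrix n n ℂ} (hY : Y ∈ frameFreeBlockLandauW (d := d) (n := n) L N k W)
    {η' : Site d → Fin d → Matrix n n ℂ} (hη'P : IsPeriodicDir η' ((tower L N k : ℕ) : ℤ)) {ζ' ζt : Site d → Matrix n n ℂ}
    (hζtP : ∀ (x : Site d) (τ : Fin d), ζt (x + ((tower L N k : ℕ) : ℤ) • e τ) = ζt x)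
    (hYeq : ∀ (x : Site d) (κ : Fin d), Y x κ = η' x κ + gaugeDir W ζ' x κ)
    (hξ : (fun x => ζt x - ζ' x) ∈ cornerGaugeSpaceW (d := d) (n := n) L k W (tower L N k) (L ^ k)) :
    ∑ x ∈ periodBox (d := d) (tower L N k), ∑ κ : Fin d, nhsNormSq (Y x κ)
      ≤ ∑ x ∈ periodBox (d := d) (tower L N k), ∑ κ : Fin d, nhsNormSq (η' x κ)
        + ∑ x ∈ periodBox (d := d) (tower L N k), ∑ κ : Fin d, nhsNormSq (gaugeDir W ζt x κ)
        + 2 * ∑ x ∈ periodBox (d := d) (tower L N k), hsR (covDiv W η' x) (ζt x) := by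
  have h1 := sum_nhsNormSq_le_of_mem hY hξ
  have hpt : ∀ (x : Site d) (κ : Fin d), Y x κ + gaugeDir W (fun y => ζt y - ζ' y) x κ = η' x κ + gaugeDir W ζt x κ := by
    intro x κ
    rw [gaugeDir_sub_fun', hYeq x κ]
    abel
  simp_rw [hpt] at h1
  rw [sum_nhsNormSq_add_gaugeDir_eq hP hWu hη'P hζtP] at h1
  exact h1

/-- **THE S6∘S8 STEP WITH THE SPECTRAL ORTHOGONALITY IN PLACE** («`⟨ρ, ζ̃′⟩ = ⟨ρ, ξ⟩`», ρ-g23-3 (S8)): under (S2)(iii)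
`Σ_x hsR (ζ′ x) (covDiv W η′ x) = 0` the cross term only sees `ξ = ζ̃ − ζ′`:
`Σ‖Y‖² ≤ Σ‖η′‖² + Σ‖gaugeDir W ζ̃‖² + 2·Σ_x hsR (covDiv W η′ x) (ζ̃ x − ζ′ x)`. [folklore] -/
theorem sum_nhsNormSq_le_competitor_of_orth {L N k : ℕ} (hP : 1 ≤ tower L N k) {W : Site d → Fin d → (Matrix n n ℂ)ˣ}
    (hWu : IsUnitaryCfg W) {Y : Site d → Fin d → Matrix n n ℂ} (hY : Y ∈ frameFreeBlockLandauW (d := d) (n := n) L N k W)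
    {η' : Site d → Fin d → Matrix n n ℂ} (hη'P : IsPeriodicDir η' ((tower L N k : ℕ) : ℤ)) {ζ' ζt : Site d → Matrix n n ℂ}
    (hζtP : ∀ (x : Site d) (τ : Fin d), ζt (x + ((tower L N k : ℕ) : ℤ) • e τ) = ζt x)
    (hYeq : ∀ (x : Site d) (κ : Fin d), Y x κ = η' x κ + gaugeDir W ζ' x κ)
    (hξ : (fun x => ζt x - ζ' x) ∈ cornerGaugeSpaceW (d := d) (n := n) L k W (tower L N k) (L ^ k))
    (horth : ∑ x ∈ periodBox (d := d) (tower L N k), hsR (ζ' x) (covDiv W η' x) = 0) :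
    ∑ x ∈ periodBox (d := d) (tower L N k), ∑ κ : Fin d, nhsNormSq (Y x κ)
      ≤ ∑ x ∈ periodBox (d := d) (tower L N k), ∑ κ : Fin d, nhsNormSq (η' x κ)
        + ∑ x ∈ periodBox (d := d) (tower L N k), ∑ κ : Fin d, nhsNormSq (gaugeDir W ζt x κ)
        + 2 * ∑ x ∈ periodBox (d := d) (tower L N k), hsR (covDiv W η' x) (ζt x - ζ' x) := by
  have h := sum_nhsNormSq_le_competitor hP hWu hY hη'P hζtP hYeq hξ
  have hsplit : ∑ x ∈ periodBox (d := d) (tower L N k), hsR (covDiv W η' x) (ζt x)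
      = ∑ x ∈ periodBox (d := d) (tower L N k), hsR (covDiv W η' x) (ζt x - ζ' x)
        + ∑ x ∈ periodBox (d := d) (tower L N k), hsR (ζ' x) (covDiv W η' x) := by
    rw [← Finset.sum_add_distrib]
    refine Finset.sum_congr rfl fun x _ => ?_
    rw [hsR_sub_right, hsR_comm (ζ' x)]
    ring
  rw [hsplit, horth, add_zero] at h
  exact h

/-! ## §3 Currency: nhs sums into the operator-norm wall `SlicePoincare` -/

/-- `dirSq Y F ≤ card n · Σ_F Σ_κ nhsNormSq (Y x κ)` (`‖X‖² ≤ card n·nhsNormSq X`). [folklore] -/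
theorem dirSq_le_card_mul (Y : Site d → Fin d → Matrix n n ℂ) (F : Finset (Site d)) :
    dirSq Y F ≤ (Fintype.card n : ℝ) * ∑ x ∈ F, ∑ κ : Fin d, nhsNormSq (Y x κ) := by
  unfold dirSq
  rw [Finset.mul_sum]
  refine Finset.sum_le_sum fun x _ => ?_
  rw [Finset.mul_sum]
  exact Finset.sum_le_sum fun κ _ => opNorm_sq_le_card_mul_nhsNormSq _

/-- `Σ_{z∈F} Σ_π nhsNormSq (curl W Y (z, π)) ≤ curlSq W Y F` (`nhsNormSq X ≤ ‖X‖²`). [folklore] -/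
theorem sum_nhsNormSq_curl_le_curlSq (W : Site d → Fin d → (Matrix n n ℂ)ˣ) (Y : Site d → Fin d → Matrix n n ℂ) (F : Finset (Site d)) :
    ∑ z ∈ F, ∑ π : T4AveragingDeficitWall.Plane d, nhsNormSq (curl W Y (z, π)) ≤ curlSq W Y F := by
  unfold curlSq
  exact Finset.sum_le_sum fun z _ => Finset.sum_le_sum fun π _ => nhsNormSq_le_opNorm_sq _

/-- **AN nhs-CURRENCY SLICE INEQUALITY IS `SlicePoincare` WITH THE FACTOR `card n`**: if every `Y ∈ T` satisfies
`Σ_F Σ_κ nhsNormSq (Y x κ) ≤ C·(L^k)²·Σ_{z∈F} Σ_π nhsNormSq (curl W Y (z, π))` (`0 ≤ C`), then `SlicePoincare L k W T (card n·C) F`. [folklore] -/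
theorem slicePoincare_of_nhs {L k : ℕ} {W : Site d → Fin d → (Matrix n n ℂ)ˣ} {T : Set (Site d → Fin d → Matrix n n ℂ)} {C : ℝ}
    (hC : 0 ≤ C) {F : Finset (Site d)}
    (h : ∀ Y ∈ T, ∑ x ∈ F, ∑ κ : Fin d, nhsNormSq (Y x κ)
      ≤ C * ((L : ℝ) ^ k) ^ 2 * ∑ z ∈ F, ∑ π : T4AveragingDeficitWall.Plane d, nhsNormSq (curl W Y (z, π))) :
    SlicePoincare L k W T ((Fintype.card n : ℝ) * C) F := by
  intro Y hY
  have hcard : (0 : ℝ) ≤ (Fintype.card n : ℝ) := Nat.cast_nonneg _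
  have hcurl : 0 ≤ curlSq W Y F := by unfold curlSq; positivity
  have hS : 0 ≤ ∑ z ∈ F, ∑ π : T4AveragingDeficitWall.Plane d, nhsNormSq (curl W Y (z, π)) :=
    Finset.sum_nonneg fun _ _ => Finset.sum_nonneg fun _ _ => nhsNormSq_nonneg _
  have h1 := h Y hY
  have h2 := dirSq_le_card_mul (n := n) Y F
  have h3 := sum_nhsNormSq_curl_le_curlSq W Y F
  set M : ℝ := (L : ℝ) ^ k with hM
  by_cases hM0 : M = 0
  · -- degenerate `L = 0` (then `k ≥ 1`): the weighted left-hand side vanishes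
    rw [hM0, inv_zero]
    have : (0 : ℝ) ^ 2 * dirSq Y F = 0 := by ring
    rw [this]
    exact mul_nonneg (mul_nonneg hcard hC) hcurl
  · have hMpos : 0 < M ^ 2 := by positivity
    -- `(M⁻¹)²·dirSq ≤ (M⁻¹)²·card n·C·M²·Σ nhs curl = card n·C·Σ nhs curl ≤ card n·C·curlSq`
    have h4 : dirSq Y F ≤ (Fintype.card n : ℝ) * (C * M ^ 2 * ∑ z ∈ F, ∑ π : T4AveragingDeficitWall.Plane d,
        nhsNormSq (curl W Y (z, π))) := h2.trans (mul_le_mul_of_nonneg_left h1 hcard)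
    have hinv : (M⁻¹) ^ 2 * M ^ 2 = 1 := by rw [inv_pow, inv_mul_cancel₀ hMpos.ne']
    calc (M⁻¹) ^ 2 * dirSq Y F
        ≤ (M⁻¹) ^ 2 * ((Fintype.card n : ℝ) * (C * M ^ 2 * ∑ z ∈ F, ∑ π : T4AveragingDeficitWall.Plane d,
            nhsNormSq (curl W Y (z, π)))) := mul_le_mul_of_nonneg_left h4 (by positivity)
      _ = ((M⁻¹) ^ 2 * M ^ 2) * ((Fintype.card n : ℝ) * C) * ∑ z ∈ F, ∑ π : T4AveragingDeficitWall.Plane d,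
            nhsNormSq (curl W Y (z, π)) := by ring
      _ = ((Fintype.card n : ℝ) * C) * ∑ z ∈ F, ∑ π : T4AveragingDeficitWall.Plane d, nhsNormSq (curl W Y (z, π)) := by
            rw [hinv, one_mul]
      _ ≤ ((Fintype.card n : ℝ) * C) * curlSq W Y F := mul_le_mul_of_nonneg_left h3 (mul_nonneg hcard hC)

/-! ## §4 The ε-budget lemma -/

/-- **THE ε-BUDGET LEMMA OF S8** (pure real arithmetic): from `y² ≤ h² + D² + X`, `h² ≤ a₁·c + e₁·y²`, `D² ≤ a₂·c + e₂·y²`, `X ≤ e₃·y²`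
and `e₁ + e₂ + e₃ ≤ 1∕2` (with `0 ≤ y²`) conclude `y² ≤ 2·(a₁ + a₂)·c`. [folklore] -/
theorem sq_le_of_budget {y2 h2 D2 X a₁ a₂ c e₁ e₂ e₃ : ℝ} (hy : 0 ≤ y2) (h0 : y2 ≤ h2 + D2 + X) (h1 : h2 ≤ a₁ * c + e₁ * y2)
    (h2' : D2 ≤ a₂ * c + e₂ * y2) (h3 : X ≤ e₃ * y2) (he : e₁ + e₂ + e₃ ≤ 1 / 2) : y2 ≤ 2 * (a₁ + a₂) * c := by
  have h4 : y2 ≤ (a₁ + a₂) * c + (e₁ + e₂ + e₃) * y2 := by nlinarith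
  have h5 : (e₁ + e₂ + e₃) * y2 ≤ (1 / 2) * y2 := mul_le_mul_of_nonneg_right he hy
  nlinarith

/-- The same with the cross term given through Cauchy–Schwarz: `X = 2·|K|`, `|K| ≤ √(e₃'·y²)·√(y²)`-free form — if `X ≤ 2·B` and
`2·B ≤ e₃·y²` then `X ≤ e₃·y²` (bookkeeping helper). [folklore] -/
theorem le_of_two_mul_le {X B e₃ y2 : ℝ} (hX : X ≤ 2 * B) (hB : 2 * B ≤ e₃ * y2) : X ≤ e₃ * y2 := hX.trans hB

end

end Summit.QuantumFields.BalabanUV.T4Continuum.NE3SlicePoincareSkeleton
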